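import Summits.QuantumFields.YangMills.Theorems.BalabanUVNodesN07KnitTokensLandauTwoOfRows
import Summits.QuantumFields.YangMills.Theorems.BalabanUVNodesN07EmapOfRecordTraceSectors
import HarnessLib

/-!
# N07 ∕ K0ᴬ at `N = 2` — THE KNIT CHAIN FROM NAMED ROWS, `T47` REALITY∕TRACE ROWS DISCHARGED: ✓`knitTokens_landau_two_of_rows` (LANDED-10) with its displayed «`T47 A′` Hermitian-presented
# and traceless on the Landau ball» row PROVED from the section's Sect. C rows by this lineage's ✓`conjJet_T47OfRecord_eq` ∕ ✓`trace_equiv_T47OfRecord_eq_zero_two`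

Cell `pub-ymgap`, seat `pub-ymgap-dag-n07-w3` (g29, WIDTH SEAT 3 on N07 [B11] = [15]); helper file keyed `--kind proof --supports stmt-QuantumFields-27238 --as helper` (K0ᴬ road);
count-neutral.  INTENT-11 of the seat.  After this file the four knit tokens at `N = 2` for the Landau family at `𝔖♭.chartLin T♭` display, besides file 4's Sect. C ∕ standard ∕ numeric rows,
ONLY def-Y-side rows: `HessSymmTok`, `Delta2Tok`, «`RD*(S.𝔄 V) = 0`» ((45) 2nd row for the slot-(c) `H₁`) and THE F-H ROW «`RD*(Emap H₁♭ C^{sl} ε_C A′) = 0`».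

## Honest labels

As LANDED-10: the F-H row is false for `H₁♭` off the flat locus (RR-2's TRACE FLAG F-H) ⇒ vacuous there by design, print's statement at `H_π` after def-Y's re-key.  Nothing of Bałaban's estimates
proved; K0ᴬ ⟨27238⟩ NOT closed; N07 NOT discharged; COUNT∕K UNMOVED; R4 is the conditional finite-𝕋⁴ rung `BalabanLadder.UV` only; finite torus at fixed `ε` — nothing continuum ∕ OS ∕ Clay.
**The Yang–Mills mass gap is NOT proved by any of this.**  No `sorry`, no `def`, no `instance ∕ notation ∕ set_option`; standard axioms.
[cite: Balaban1985Variational, Thm 1 p.279, Prop. 5 p.294, Prop. 6 p.295, Prop. 7 p.299, (45)–(51) pp.285–286, (74)–(84) pp.289–290, (100)–(111) pp.293–294; Balaban1985BackgroundPropagators, (3.124)–(3.128) pp.420–421, (3.134) p.422; Balaban1987RG1, (0.21) p.256]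
-/

noncomputable section

open Set Metric Filter Topology
open scoped Matrix Matrix.Norms.L2Operator InnerProductSpace ComplexConjugate

namespace Summit.QuantumFields.YangMills.Theorems.N07KnitTokensLandauTwoOfRowsReal

open Literature.MathematicalPhysics.QuantumFieldTheory.Balaban1983to89
open Literature.MathematicalPhysics.QuantumFieldTheory.Balaban1983to89.T4Continuum (T4Family)
open Literature.MathematicalPhysics.QuantumFieldTheory.Balaban1983to89.Node00
open B9Eq311TracePairing (starW)
open B11Eq103H1Complex (SiteL2K BondL2K readFun funEquiv QFun covDivL2K)
open B11Eq111FrakG (nabla115)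
open B11Eq115Space (NegSize NegSup JetSup)
open B11Eq174Chart (Regime)
open B11Prop6Scheme (Prop4Hyp mapT)
open B11Eq90V0GroupComposed (T47)
open B11Eq80Current (Emap)
open Summit.QuantumFields.YangMills.Theorems.N07TraceSectorDefs (scalPartW)
open Summit.QuantumFields.YangMills.Theorems.N07KnitTokensLandauTwoOfRows (knitTokens_landau_two_of_rows)
open Summit.QuantumFields.YangMills.Theorems.N07EmapOfRecordRealSlice (conjJet_T47OfRecord_eq)
open Summit.QuantumFields.YangMills.Theorems.N07EmapOfRecordTraceSectors (trace_equiv_T47OfRecord_eq_zero_two)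
open Summit.QuantumFields.YangMills.Theorems.N07LieTokAtOfRecordTwo (conjJet_eq_self_iff mem_evHerm0_ofRecord_iff)

/-! ## The knit chain at `N = 2`, `T47` rows discharged -/

section Two

variable (F : T4Family) {K : ℕ} (k : ℕ) (Ω : ℕ → Set (Site (F.P K) 0)) (U₀ : GaugeField (F.P K) 0 (SU 2))
  [Fact (0 < (F.L : ℝ))] [Fact (0 < (F.P K).eta k)] (levB : PBond (F.P K) k → ℕ) [Fact (0 < c0Rec F K k)] [Fact (∀ c, 0 < wBRec F K k c)] (a : ℝ)
  (hposb : ∀ x, x ≠ 0 → 0 < RCLike.re ⟪x, laplaceAOfRecord F 2 k U₀ (QOfRecord F 2 k U₀) (QflatOfRecord F 2 k) a x⟫_ℂ)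
  (hQ : Function.Surjective (QOfRecord F 2 k U₀)) {b C₂ c₄ aC εC : ℝ}
  (RC : Regime (H1OfRecordAtBgFlat F 2 K k Ω U₀ levB a hposb hQ) 0 (CslOfRecord F 2 K k Ω U₀ levB) b 0 C₂ c₄ 0 aC εC)
  (hCreal : ∀ A : Space115Lit F 2 K k Ω U₀,
    ((JetSup.equiv _ _ (nabla115 ((F.P K).eta k) (unitsOfRecord F 2 U₀))).symm
        (star (JetSup.equiv _ _ (nabla115 ((F.P K).eta k) (unitsOfRecord F 2 U₀)) A)) : Space115Lit F 2 K k Ω U₀) = A →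
    ‖A‖ ≤ εC + aC → ((NegSup.equiv _ _).symm (star (NegSup.equiv _ _ (CslOfRecord F 2 K k Ω U₀ levB A))) :
      NegSize (F.L : ℝ) ((F.P K).eta k) levB 0 (Matrix (Fin 2) (Fin 2) ℂ)) = CslOfRecord F 2 K k Ω U₀ levB A)
  (hCtr : ∀ A : Space115Lit F 2 K k Ω U₀,
    ((JetSup.equiv _ _ (nabla115 ((F.P K).eta k) (unitsOfRecord F 2 U₀))).symm
        (star (JetSup.equiv _ _ (nabla115 ((F.P K).eta k) (unitsOfRecord F 2 U₀)) A)) : Space115Lit F 2 K k Ω U₀) = A →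
    (∀ b, (JetSup.equiv _ _ (nabla115 ((F.P K).eta k) (unitsOfRecord F 2 U₀)) A b).trace = 0) →
    ‖A‖ ≤ εC + aC → ∀ c, (NegSup.equiv _ _ (CslOfRecord F 2 K k Ω U₀ levB A) c).trace = 0)
  (Gp : SiteL2K ℂ (F.P K).d (fun _ => (F.P K).sitesPerDir 0) (c0Rec F K k) (WRec 2) →ₗ[ℂ]
    SiteL2K ℂ (F.P K).d (fun _ => (F.P K).sitesPerDir 0) (c0Rec F K k) (WRec 2))
  (Δ2 : BondL2K ℂ (F.P K).d (fun _ => (F.P K).sitesPerDir 0) (c0Rec F K k) (WRec 2) →ₗ[ℂ]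
    BondL2K ℂ (F.P K).d (fun _ => (F.P K).sitesPerDir 0) (c0Rec F K k) (WRec 2))
  (hposπ : ∀ x, x ≠ 0 → 0 < RCLike.re ⟪x, laplaceAOfRecordAt F 2 k U₀ (hessOpOfRecord128 F 2 k U₀ Gp (QflatOfRecord F 2 k) Δ2)
    (QOfRecord F 2 k U₀) (QflatOfRecord F 2 k) a x⟫_ℂ)

include RC hCreal hCtr in
/-- ★★★ **THE FOUR KNIT TOKENS AT `N = 2` FOR THE LANDAU FAMILY FROM NAMED ROWS, `T47` ROWS DISCHARGED**: ✓`knitTokens_landau_two_of_rows` with the reality∕trace rows of `T47 A′` proved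
from the section's Sect. C rows (`h`, `RC`, `hCreal`, `hCtr`) via ✓`conjJet_T47OfRecord_eq` ∕ ✓`trace_equiv_T47OfRecord_eq_zero_two` (`A′ ∈ evHerm0` gives the Hermitian∕traceless input by
✓`mem_evHerm0_ofRecord_iff`; `‖A′‖ < ρ₀ ≤ a_C`).  Remaining displayed def-Y-side rows: `HessSymmTok`, `Delta2Tok`, «`RD*(S.𝔄 V) = 0`», THE F-H ROW.
[cite: Balaban1985Variational, Thm 1 p.279, Prop. 6 p.295, (45)–(51) pp.285–286, (74)–(84) pp.289–290, (100)–(111) pp.293–294; Balaban1985BackgroundPropagators, (3.124)–(3.128) pp.420–421] -/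
theorem knitTokens_landau_two_of_rows_real (h : SmallBelow (avOfRecord F 2 K) k U₀) {ε : ℝ} (hU₀reg : U₀ ∈ bgReg F 2 K k ε)
    (hC : Prop4Hyp (CslOfRecord F 2 K k Ω U₀ levB) C₂ c₄) (haC : 0 < aC)
    (ι : Space115Lit F 2 K k Ω U₀ ≃ₗ[ℂ] BondL2K ℂ (F.P K).d (fun _ => (F.P K).sitesPerDir 0) (c0Rec F K k) (WRec 2))
    (hι : ∀ y, ι y = (funEquiv (phiRec 2) (fun _ : B9SectCLatticeCarrier.Bond (F.P K).d (fun _ => (F.P K).sitesPerDir 0) => c0Rec F K k)).symm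
      (JetSup.equiv _ _ (nabla115 ((F.P K).eta k) (unitsOfRecord F 2 U₀)) y))
    (hsym : HessSymmTok F 2 K k U₀ Δ2) (hΔ2 : Delta2Tok F 2 K k Ω U₀ levB a hposb hQ Δ2) :
    ∃ ρ₀ M γ : ℝ, 0 < ρ₀ ∧ ρ₀ ≤ aC ∧ 0 ≤ M ∧ 0 < γ ∧
      ∀ (dom : Set (GaugeField (F.P K) k (SU 2))) (B₀ C₄ a₃ j a𝔄 ε₄ ρ : ℝ)
        (S : BgSchemeOnLit F 2 K k Ω U₀) (_hS : S = bgSchemeOfRecord F 2 K k Ω U₀ dom levB Gp Δ2 a hposπ hposb hQ εC B₀ C₄ a₃ j a𝔄 ε₄),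
        ρ ≤ ρ₀ → ε₄ + a𝔄 ≤ ρ → 2 * (ρ + a𝔄 + a𝔄) ≤ a₃ → 4 * M * B₀ * C₄ * (ρ + a𝔄 + a𝔄) < γ →
        dom ⊆ logDiscOfRecord F 2 K k U₀ → S.RegimeTok → FrakGSliceTok F 2 K k Ω U₀ Gp Δ2 a hposπ hQ → (∀ V ∈ dom, S.LieTokAt V) →
        -- the Landau row of `𝔄V = H₁B(V)`: `RD*𝔄V = 0` (print's (45) 2nd row for the slot-(c) `H₁`; read on `L²`)
        (∀ V ∈ dom, RrOfRecord F 2 k U₀ (QflatOfRecord F 2 k) (covDivL2K ℂ (c0Rec F K k) (cRec F K k) (SRec F 2 U₀) (ι (S.𝔄 V))) = 0) →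
        -- THE F-H ROW: `RD*(H₁♭ D(A′)) = 0` on the Landau ball (print's (45) 2nd row ∘ (76); NOT a theorem for `H₁♭` off the flat locus — RR-2's TRACE FLAG F-H)
        (∀ A' : Space115Lit F 2 K k Ω U₀, A' ∈ S.evHerm0 → RrOfRecord F 2 k U₀ (QflatOfRecord F 2 k) (covDivL2K ℂ (c0Rec F K k) (cRec F K k) (SRec F 2 U₀) (ι A')) = 0 → ‖A'‖ < ρ₀ →
          RrOfRecord F 2 k U₀ (QflatOfRecord F 2 k) (covDivL2K ℂ (c0Rec F K k) (cRec F K k) (SRec F 2 U₀) (ι (Emap (H1OfRecordAtBgFlat F 2 K k Ω U₀ levB a hposb hQ) (CslOfRecord F 2 K k Ω U₀ levB) εC A'))) = 0) →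
        -- (rng)
        (∀ V ∈ S.dom, ∀ A ∈ {A : Space115Lit F 2 K k Ω U₀ | A ∈ constraint102OfRecord F 2 K k Ω U₀ ∧ A + S.𝔄 V ∈ S.evHerm0 ∧ ‖A + S.𝔄 V‖ < ρ},
          S.chartLin (fun _ => T47 (H1OfRecordAtBgFlat F 2 K k Ω U₀ levB a hposb hQ) (CslOfRecord F 2 K k Ω U₀ levB) εC) V A ∈ bgReg F 2 K k ε ∧
          Averaging.iter (avOfRecord F 2 K) k
            (S.chartLin (fun _ => T47 (H1OfRecordAtBgFlat F 2 K k Ω U₀ levB a hposb hQ) (CslOfRecord F 2 K k Ω U₀ levB) εC) V A) = V) ∧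
        -- (star_mem)
        (∀ V ∈ S.dom, S.sol V ∈ {A : Space115Lit F 2 K k Ω U₀ | A ∈ constraint102OfRecord F 2 K k Ω U₀ ∧ A + S.𝔄 V ∈ S.evHerm0 ∧ ‖A + S.𝔄 V‖ < ρ}) ∧
        -- (min)
        (∀ V ∈ S.dom, IsMinOn (wilsonAction4 ∘ S.chartLin
              (fun _ => T47 (H1OfRecordAtBgFlat F 2 K k Ω U₀ levB a hposb hQ) (CslOfRecord F 2 K k Ω U₀ levB) εC) V)
            {A : Space115Lit F 2 K k Ω U₀ | A ∈ constraint102OfRecord F 2 K k Ω U₀ ∧ A + S.𝔄 V ∈ S.evHerm0 ∧ ‖A + S.𝔄 V‖ < ρ} (S.sol V)) ∧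
        -- (c→s)
        (∀ V ∈ S.dom, ∀ A ∈ {A : Space115Lit F 2 K k Ω U₀ | A ∈ constraint102OfRecord F 2 K k Ω U₀ ∧ A + S.𝔄 V ∈ S.evHerm0 ∧ ‖A + S.𝔄 V‖ < ρ},
          IsMinOn (wilsonAction4 ∘ S.chartLin
              (fun _ => T47 (H1OfRecordAtBgFlat F 2 K k Ω U₀ levB a hposb hQ) (CslOfRecord F 2 K k Ω U₀ levB) εC) V)
            {A : Space115Lit F 2 K k Ω U₀ | A ∈ constraint102OfRecord F 2 K k Ω U₀ ∧ A + S.𝔄 V ∈ S.evHerm0 ∧ ‖A + S.𝔄 V‖ < ρ} A →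
          ‖A‖ ≤ S.ε₄ ∧ mapT (S.𝒢 V) 0 (S.W V) (S.J V) (S.𝔄 V) A = A) := by
  obtain ⟨ρ₀, M, γ, hρ₀, hρ₀aC, hM, hγ, hmain⟩ :=
    knitTokens_landau_two_of_rows F k Ω U₀ levB a hposb hQ RC hCreal hCtr Gp Δ2 hposπ h hU₀reg hC haC ι hι hsym hΔ2
  refine ⟨ρ₀, M, γ, hρ₀, hρ₀aC, hM, hγ, ?_⟩
  intro dom B₀ C₄ a₃ j a𝔄 ε₄ ρ S hS hρ hfit hdom hnum hdisc hR h𝔊 hL h𝔄L hFH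
  refine hmain dom B₀ C₄ a₃ j a𝔄 ε₄ ρ S hS hρ hfit hdom hnum hdisc hR h𝔊 hL h𝔄L ?_ hFH
  intro A' hh _ hlt
  subst hS
  obtain ⟨hconj, htr⟩ := (mem_evHerm0_ofRecord_iff F 2 K k Ω U₀ dom levB Gp Δ2 a hposπ hposb hQ εC B₀ C₄ a₃ j a𝔄 ε₄ A').1 hh
  have hn : ‖A'‖ < aC := lt_of_lt_of_le hlt hρ₀aC
  exact ⟨(conjJet_eq_self_iff F 2 K k Ω U₀ _).1 (conjJet_T47OfRecord_eq F 2 K k Ω U₀ levB hposb hQ RC hCreal h hconj hn),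
    trace_equiv_T47OfRecord_eq_zero_two F k Ω U₀ levB hposb hQ RC hCreal hCtr h hconj htr hn⟩

end Two

end Summit.QuantumFields.YangMills.Theorems.N07KnitTokensLandauTwoOfRowsReal

end
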